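import Summits.MatrixMultiplication.OmegaCensus.SmallFormats.RankOnePlaneCapEquality
import HarnessLib

/-!
# ω-census family (a): the saturated rank-one plane law for the COLUMN planes `{z λᵀ}`

Cell `pub-omega` (unit `pub-omega-lit`, gen 6), topic `Summits/MatrixMultiplication/OmegaCensus`
(sub-folder `SmallFormats`). Framing (verbatim): lottery ticket; floor = certified bounds/negative
ranges. HONEST FRAMING: our elementary structural lemma; the mirror image of
`RankOnePlaneCapEquality.card_vanishing_quant_eq` under the transpose-dual symmetry
`(X, Y, Z) ↦ (Xᵀ, Zᵀ, Yᵀ)` (`exists_transposeDual`, here re-proved with all three components exposed),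
written out in terms of the ORIGINAL computation so that the structured searches can cite it: for a
column-type plane `{z λᵀ : z ∈ k^c} ⊂ k^{c×m}` (`λ ∈ k^m ∖ 0`) carrying exactly the cap number of
vanishing X-forms (`c·cn + cn + c|R| = c r + |R|`; for `⟨2,2,n⟩`: `|R| = 2r − 6n`), the roles of the
Y-coefficient matrices `G_i` (`G_i μ ν = g_i(E_{μν})`) and of the outputs `W_i` are EXCHANGED:
* with `θ ⊥ λ` (`θ ∈ k^m`) and `E := span{θᵀ G_i : i ∉ R} ⊂ kⁿ`: `dim E + cn = r − |R|`;
* the OUTPUTS `W_i`, `i ∈ R`, are linearly independent, and a matrix `Y' ∈ k^{c×n}` is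
  Frobenius-orthogonal to all of them iff all rows of `Y'` lie in `E` — i.e. every `W_i` (`i ∈ R`) has
  all its rows in `F := E^⊥` (and the `W_i`, `i ∈ R`, span `k^c ⊗ F`).
Not a bound on any rank, not progress on `ω`.
-/

namespace Summit.MatrixMultiplication.OmegaCensus.RankOnePlaneCapGeneral

open Module Matrix Literature.Computability.AlgebraicComplexity

variable {k : Type*} [Field k] {c m n : ℕ} {ι : Type*} [Fintype ι]

/-- The transpose-dual computation `⟨c,m,n⟩ → ⟨m,c,n⟩` with all three components exposed:
X-forms `X' ↦ f_i(X'ᵀ)`, Y-forms `Y' ↦ ∑ W_i κ ν · Y' κ ν`, outputs `G_i μ ν = g_i(E_{μν})`. -/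
theorem exists_transposeDual' (β : BilinComp (mulBilin k c m n) ι) :
    ∃ β' : BilinComp (mulBilin k m c n) ι,
      (∀ i X', β'.f i X' = β.f i X'ᵀ) ∧
      (∀ i Y', β'.g i Y' = ∑ κ, ∑ ν, β.w i κ ν * Y' κ ν) ∧
      (∀ i, β'.w i = Matrix.of fun μ ν => β.g i (Matrix.single μ ν (1 : k))) := by
  classical
  refine ⟨{ f := fun i =>
              { toFun := fun X' => β.f i X'ᵀ
                map_add' := fun X X' => by rw [Matrix.transpose_add, map_add]
                map_smul' := fun a X => by rw [Matrix.transpose_smul, map_smul]; rfl }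
            g := fun i =>
              { toFun := fun Y' => ∑ κ, ∑ ν, β.w i κ ν * Y' κ ν
                map_add' := fun Y Y' => by
                  simp only [Matrix.add_apply, mul_add, Finset.sum_add_distrib]
                map_smul' := fun a Y => by
                  simp only [Matrix.smul_apply, smul_eq_mul, RingHom.id_apply, Finset.mul_sum]
                  exact Finset.sum_congr rfl fun κ _ => Finset.sum_congr rfl fun ν _ => by ring }
            w := fun i => Matrix.of fun μ ν => β.g i (Matrix.single μ ν (1 : k))
            map_eq_sum := ?_ }, fun i X' => rfl, fun i Y' => rfl, fun i => rfl⟩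
  intro X' Y'
  rw [mulBilin_apply]
  ext a b
  have hβ : ∀ κ ν, (∑ i, (β.f i X'ᵀ * β.g i (Matrix.single a b (1 : k))) * β.w i κ ν)
      = if ν = b then X' a κ else 0 := by
    intro κ ν
    have h := β.map_eq_sum X'ᵀ (Matrix.single a b (1 : k))
    rw [mulBilin_apply] at h
    have h2 := congrFun (congrFun h κ) ν
    rw [mul_single_apply', Matrix.transpose_apply] at h2
    rw [h2, Matrix.sum_apply]
    exact Finset.sum_congr rfl fun i _ => by simp
  simp only [LinearMap.coe_mk, AddHom.coe_mk, Matrix.sum_apply, Matrix.smul_apply, Matrix.of_apply,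
    smul_eq_mul]
  calc (X' * Y') a b = ∑ κ, X' a κ * Y' κ b := Matrix.mul_apply
    _ = ∑ κ, ∑ ν, Y' κ ν * (if ν = b then X' a κ else 0) := by
        refine Finset.sum_congr rfl fun κ _ => ?_
        simp [mul_comm]
    _ = ∑ κ, ∑ ν, Y' κ ν * ∑ i, (β.f i X'ᵀ * β.g i (Matrix.single a b (1 : k))) * β.w i κ ν := by
        simp_rw [hβ]
    _ = ∑ κ, ∑ ν, ∑ i, Y' κ ν * ((β.f i X'ᵀ * β.g i (Matrix.single a b (1 : k))) * β.w i κ ν) := by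
        simp_rw [Finset.mul_sum]
    _ = ∑ κ, ∑ i, ∑ ν, Y' κ ν * ((β.f i X'ᵀ * β.g i (Matrix.single a b (1 : k))) * β.w i κ ν) :=
        Finset.sum_congr rfl fun κ _ => Finset.sum_comm
    _ = ∑ i, ∑ κ, ∑ ν, Y' κ ν * ((β.f i X'ᵀ * β.g i (Matrix.single a b (1 : k))) * β.w i κ ν) :=
        Finset.sum_comm
    _ = ∑ i, (β.f i X'ᵀ * ∑ κ, ∑ ν, β.w i κ ν * Y' κ ν) * β.g i (Matrix.single a b (1 : k)) := by
        refine Finset.sum_congr rfl fun i _ => ?_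
        rw [Finset.mul_sum, Finset.sum_mul]
        refine Finset.sum_congr rfl fun κ _ => ?_
        rw [Finset.mul_sum, Finset.sum_mul]
        exact Finset.sum_congr rfl fun ν _ => by ring

/-- The Frobenius pairing `W ↦ (Y' ↦ ∑ W κ ν · Y' κ ν)` as a linear map into the dual. -/
private def frob (c n : ℕ) : Matrix (Fin c) (Fin n) k →ₗ[k] Module.Dual k (Matrix (Fin c) (Fin n) k) where
  toFun W :=
    { toFun := fun Y' => ∑ κ, ∑ ν, W κ ν * Y' κ ν
      map_add' := fun Y Y' => by simp only [Matrix.add_apply, mul_add, Finset.sum_add_distrib]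
      map_smul' := fun a Y => by
        simp only [Matrix.smul_apply, smul_eq_mul, RingHom.id_apply, Finset.mul_sum]
        exact Finset.sum_congr rfl fun κ _ => Finset.sum_congr rfl fun ν _ => by ring }
  map_add' W W' := by
    ext Y'
    simp only [Matrix.add_apply, add_mul, Finset.sum_add_distrib, LinearMap.coe_mk, AddHom.coe_mk,
      LinearMap.add_apply]
  map_smul' a W := by
    ext Y'
    simp only [Matrix.smul_apply, smul_eq_mul, RingHom.id_apply, LinearMap.coe_mk, AddHom.coe_mk,
      LinearMap.smul_apply, Finset.mul_sum]
    exact Finset.sum_congr rfl fun κ _ => Finset.sum_congr rfl fun ν _ => by ring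

/-- **The saturated law for column planes** `{z λᵀ : z ∈ k^c}` (`λ ∈ k^m ∖ 0`, `m ≥ 2`, `c ≥ 1`), in
terms of the original computation: if `c·cn + cn + c|R| = c r + |R|` for a set `R` of indices whose
X-forms vanish on the plane, then with `θ ⊥ λ` and `E = span{θᵀ G_i : i ∉ R}`
(`G_i μ ν = g_i(E_{μν})` the Y-coefficient matrices): `dim E + cn = |Rᶜ|`, a matrix `Y' ∈ k^{c×n}` is
Frobenius-orthogonal to every output `W_i`, `i ∈ R`, iff all its rows lie in `E`, and the outputs
`W_i`, `i ∈ R`, are linearly independent. -/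
theorem card_vanishing_col_quant_eq [DecidableEq ι] (hm : 2 ≤ m) (hc : 1 ≤ c)
    (β : BilinComp (mulBilin k c m n) ι) {lam : Fin m → k} (hlam : lam ≠ 0) (R : Finset ι)
    (hR : ∀ i ∈ R, ∀ z : Fin c → k, β.f i (vecMulVec z lam) = 0)
    (heq : c * (c * n) + c * n + c * R.card = c * Fintype.card ι + R.card) :
    ∃ (θ : Fin m → k) (E : Submodule k (Fin n → k)),
      θ ≠ 0 ∧ θ ⬝ᵥ lam = 0 ∧
      E = Submodule.span k
        ((fun i => θ ᵥ* Matrix.of fun μ ν => β.g i (Matrix.single μ ν (1 : k))) '' ↑(Finset.univ \ R)) ∧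
      finrank k E + c * n = (Finset.univ \ R).card ∧
      (∀ Y' : Matrix (Fin c) (Fin n) k,
        (∀ i ∈ R, (∑ κ, ∑ ν, β.w i κ ν * Y' κ ν) = 0) ↔ ∀ κ, Y' κ ∈ E) ∧
      LinearIndependent k (fun i : {i // i ∈ R} => β.w i.1) := by
  obtain ⟨β', hf, hg, hw⟩ := exists_transposeDual' β
  have hR' : ∀ i ∈ R, ∀ z : Fin c → k, β'.f i (vecMulVec lam z) = 0 := by
    intro i hi z
    rw [hf, Matrix.transpose_vecMulVec]
    exact hR i hi z
  obtain ⟨θ, E, hθ, hθlam, hE, hdim, hzero, hli⟩ :=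
    card_vanishing_quant_eq hm hc β' hlam R hR' heq
  refine ⟨θ, E, hθ, hθlam, ?_, hdim, ?_, ?_⟩
  · rw [hE]
    congr 1
    ext v
    simp only [Set.mem_image, hw]
  · intro Y'
    rw [← hzero Y']
    simp only [hg]
  · have hcomp : (fun i : {i // i ∈ R} => β'.g i.1) = frob c n ∘ fun i : {i // i ∈ R} => β.w i.1 := by
      funext i
      ext Y'
      rw [hg]
      rfl
    rw [hcomp] at hli
    exact hli.of_comp

/-- **`⟨c,2,n⟩` form** (in particular `⟨2,2,n⟩`): if exactly `|R| = 2r − 6n`... more precisely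
`c·cn + cn + c|R| = c r + |R|`, for `c = 2`: `|R| = 2r − 6n` X-forms vanish on the column plane
`{z λᵀ : z ∈ k²}` (`λ ∈ k² ∖ 0`), then the outputs `W_i`, `i ∈ R`, are linearly independent with all
rows in the common space `E^⊥` of dimension `r − 3n`, where `E = span{θᵀG_i : i ∉ R}` has
`dim E = |Rᶜ| − 2n`. -/
theorem card_vanishing_col_eq_two_mul_sub [DecidableEq ι] (β : BilinComp (mulBilin k 2 2 n) ι)
    {lam : Fin 2 → k} (hlam : lam ≠ 0) (R : Finset ι)
    (hR : ∀ i ∈ R, ∀ z : Fin 2 → k, β.f i (vecMulVec z lam) = 0)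
    (heq : R.card + 6 * n = 2 * Fintype.card ι) :
    ∃ (θ : Fin 2 → k) (E : Submodule k (Fin n → k)),
      θ ≠ 0 ∧ θ ⬝ᵥ lam = 0 ∧
      E = Submodule.span k
        ((fun i => θ ᵥ* Matrix.of fun μ ν => β.g i (Matrix.single μ ν (1 : k))) '' ↑(Finset.univ \ R)) ∧
      finrank k E + 2 * n = (Finset.univ \ R).card ∧
      (∀ Y' : Matrix (Fin 2) (Fin n) k,
        (∀ i ∈ R, (∑ κ, ∑ ν, β.w i κ ν * Y' κ ν) = 0) ↔ ∀ κ, Y' κ ∈ E) ∧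
      LinearIndependent k (fun i : {i // i ∈ R} => β.w i.1) :=
  card_vanishing_col_quant_eq (le_refl 2) (by norm_num) β hlam R hR (by omega)

end Summit.MatrixMultiplication.OmegaCensus.RankOnePlaneCapGeneral
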